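import Summits.QuantumFields.Balaban3D.Proofs.FibreSplit
import Summits.QuantumFields.Balaban3D.Proofs.RTAlgebra
import Summits.QuantumFields.BalabanUV.T4Continuum.Spine.NE7.QLaCriticalityAxial
import Summits.QuantumFields.YangMills.Theorems.BalabanUVNodesN08TrivialHistoryDominates

/-!
# BalabanUVNodes ∕ N08 — AXIAL DECIMATION FORGETS EVERY OBSERVABLE THAT MISSES ONE BOND PER LINE: for ANY selection `τ` of one bond position per line, the Radon–Nikodym
# transport along the axial (decimation) averaging of an integrable density that does not depend on the selected bonds is the CONSTANT `∫ρ dU` (a.e.); at print's averaging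
# [Balaban1985Averaging] (15) such a density is transported to at most its MEAN plus the guarded part — the general-position form of file 32's no-stacking step

Track A, DAG node N08 = T. Bałaban, CMP **102** (1985) 255–275 [Balaban1985UV3]: (2) p. 256 («ρ_{k+1} = Tρ_k»), (10) p. 258 («(Tρ)(V) = ∫dU δ(ŪV^{−1})ρ(U)»), (48)–(49) p. 268 (the
split of the fine integral «into two parts»), Thm 1 (5) p. 257 (bounds extensive in the CURRENT lattice); the averaging = [Balaban1985Averaging] (15) p. 19 with its axial factor; the
typed (0.4) guard = [Balaban1987RG1] (0.4) p. 253.  Cell `pub-ymgap`, width seat `pub-ymgap-dag-n08-w1` (g6), W-SEAT-START-LIST §n08 item 1 successor piece (o27) = file 33; `--supports`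
K1⁹ `StabilityBRunRowsAtRecordR13SepCoPHV` (stmt-QuantumFields-27364, KEY MAP v2; helper).  Companion of file 32 (`…N08AxialDecimationForgets`: the LAST-bond case via `AxialFibre`'s
parametrisation) and of pub-balaban3d's `Proofs.FibreSplit` (Fubini over a partition of the bonds) ∕ `Proofs.RTAlgebra` (uniqueness of renormalization images).

THE POINT (located, count-neutral).  File 32 proved that the decimation part of (15) forgets densities not depending on the LAST bond of each line.  The guard defects of the
floored Haar iterate sit wherever the cluster geometry puts them; what the no-stacking mechanism needs is forgetting for observables missing SOME bond of each line, the position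
chosen line by line.  This file proves exactly that, for an ARBITRARY selection `τ : PBond P (j+1) → ℕ`, `τ c < L`: if `ρ W = ρ W′` whenever `W`, `W′` agree off the selected bonds
`{line c (τ c)}`, then **`T^{axial}ρ = ∫ρ dU` `dV`-a.e.** (§3).  Mechanism (§2–§3): split `dU = dU_Z ⊗ dU_B` over non-selected ∕ selected bonds (`FibreSplit`); with the non-selected
variables frozen, the coarse variable of line `c` is `a_c · W(line c (τ c)) · b_c` with `a_c, b_c` the frozen partial products before ∕ after position `τ c` (§1 `pathProd_split`; the
bonds of distinct lines are distinct — the tree's `Spine.NE7.line_inj`), so `wB ↦ W̄` is a reindexing (`c ↦ line c (τ c)` is a bijection onto the selected bonds) followed by a two-sided translation —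
it pushes product Haar to product Haar (§2 `map_axialAvg_join_eq`); hence `∫ρ·(f∘axial) dU = ∫_Z ρ · (∫_B f(W̄) dU_B) dU_Z = (∫ρ)(∫f dV)`: the constant `∫ρ` is a renormalization
image of `ρ` (§3 `isRT_axial_const_of_localOff`), and renormalization images are unique a.e. (`RTAlgebra.IsRT.ae_eq`).  §4 transfers file 32's consequences to the general
position: at print's averaging `(ρ·dU_j)∘Ū_j⁻¹ ≤ (∫ρ)·dU_{j+1} + ((ρ·dU_j)↾G_j)∘Ū_j⁻¹` and the one floored step «new excess ≤ old excess MASS + fresh guard defects» for inputs local off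
ANY one-bond-per-line selection.

WHAT THIS FILE PROVES (kernel; theorems only, 0 def; [folklore] measure theory + lattice bookkeeping; nothing of the papers asserted).  Standing range `j + 1 ≤ m + K`:
* §1 (the bonds `line c t`, `t < L`, are pairwise distinct across all lines: the tree's `Spine.NE7.line_inj` of `QLaCriticalityAxial`, imported BY NAME), `selected_injective`, `pathProd_split` (`W̄(c) = a(W)·W(line c t)·b(W)` with `a`, `b` independent
  of the other bonds' … precisely: unchanged under modifications of `W` at `line c t` and off the line), `piCongrLeft_const_apply`, `splitEquiv_symm_apply`.
* §2 ★★ `map_axialAvg_join_eq` — the frozen-fibre push-forward of product Haar on the selected bonds under `wB ↦ axial(join(wZ, wB))` IS product Haar on the coarse bonds, for every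
  frozen `wZ`.
* §3 ★★★ `isRT_axial_const_of_localOff` ∕ ★★★ `rnTransport_axial_ae_eq_integral_of_localOff` — **`T^{axial}ρ = ∫ρ dU` a.e. for every integrable `ρ` local off the selected bonds**;
  ★★ `map_axialAvg_withDensity_of_localOff` (measure form, `ρ ≥ 0`).
* §4 at print's averaging `avOfPrint N S j` on `SU(N)` (every `N`, `j + 1 ≤ K`): ★★★ `map_avOfPrint_withDensity_le_of_localOff` (forgetting + fresh defects), ★★
  `floorStep_le_of_localOff` (one floored step without stacking, `f ≥ 1` local off a selection), ★★ `lintegral_massRecAC_triv_avOfPrint_le_one_add_sum_guard` (the MEAN term: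
  `∫ f_k dU_k ≤ 1 + Σ_{j<k} dU_j(G_j)` — files 28 §2 + 17b).

HONEST FRAMING: count-neutral helper; no statement about the actual iterates `f_k` (their locality is the open cluster-geometry question) and no density bound on guarded parts —
(a)′ ∕ (F) ∕ E6′ NOT decided; `PrintedUV3V` NOT proved; N08 NOT discharged; one finite 𝕋⁴ programme at fixed ε, Bałaban AS PRINTED — R4 closes the conditional finite-𝕋⁴ rung
`BalabanLadder.UV` only; the Yang–Mills mass gap (Clay) is NOT proved by any of this; nothing continuum ∕ ℝ⁴ ∕ OS.  No `sorry`, standard axioms.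
-/

noncomputable section

open MeasureTheory
open scoped ENNReal

namespace Summit.QuantumFields.YangMills.BalabanUVNodes.N08AxialDecimationForgetsSelected

open Literature.MathematicalPhysics.QuantumFieldTheory.Balaban1983to89
open Literature.MathematicalPhysics.QuantumFieldTheory.Balaban1983to89.AveragingRT
open Summit.QuantumFields.Balaban3D.Proofs
open Summit.QuantumFields.Balaban3D.Carriers
open Summit.QuantumFields.BalabanUV.T4Continuum.Spine.NE7 (line_inj)
open Summit.QuantumFields.YangMills.BalabanUVNodes.N08TrivialHistoryIteratedTransport (withDensity_rnTransport_eq_pushDensity)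

/-! ## §1 Lattice bookkeeping: the line bonds are distinct; the line product splits at any position -/
section Geometry

variable {P : Params} {j : ℕ}

/-- The selected bond `line c (τ c)` determines the line (`τ < L`). [folklore] -/
theorem selected_injective (hj : j + 1 ≤ P.m + P.K) (τ : PBond P (j + 1) → ℕ) (hτ : ∀ c, τ c < P.L) :
    Function.Injective fun c : PBond P (j + 1) => line c (τ c) :=
  fun c c' h => (line_inj hj (hτ c) (hτ c') h).1

/-- **Splitting the line product at position `t < L`**: `W̄(c) = a(W) · W(line c t) · b(W)` where `a` (the ordered product of the bonds before `t`) and `b` (after `t`) are unchanged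
when `W` is modified anywhere except at the bonds `line c s`, `s < L`, `s ≠ t` — stated without naming the partial products (an existential over such `a`, `b`). [cite: Balaban1984PropagatorsI, (1.7) p.18 (the straight contour; bookkeeping)] -/
theorem pathProd_split {G : Type*} [GaugeGroup G] (c : PBond P (j + 1)) {t : ℕ} (ht : t < P.L) :
    ∃ a b : GaugeField P j G → G,
      (∀ W, axialAvg W c = a W * W (line c t) * b W) ∧
      (∀ W W' : GaugeField P j G, (∀ s, s < P.L → s ≠ t → W (line c s) = W' (line c s)) → a W = a W' ∧ b W = b W') := by
  have hb : ∀ n : ℕ, ∃ b : GaugeField P j G → G, (∀ W, pathProd W c (t + 1 + n) = pathProd W c t * W (line c t) * b W) ∧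
      (∀ W W' : GaugeField P j G, (∀ s, s < t + 1 + n → s ≠ t → W (line c s) = W' (line c s)) → b W = b W') := by
    intro n
    induction n with
    | zero => exact ⟨fun _ => 1, fun W => by simp [pathProd], fun _ _ _ => rfl⟩
    | succ n ih =>
      obtain ⟨b, hb1, hb2⟩ := ih
      refine ⟨fun W => b W * W (line c (t + 1 + n)), fun W => ?_, fun W W' hWW' => ?_⟩
      · show pathProd W c (t + 1 + n) * W (line c (t + 1 + n)) = _
        rw [hb1 W, mul_assoc]
      · have h1 : b W = b W' := hb2 W W' fun s hs hst => hWW' s (by omega) hst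
        have h2 : W (line c (t + 1 + n)) = W' (line c (t + 1 + n)) := hWW' _ (by omega) (by omega)
        show b W * W (line c (t + 1 + n)) = b W' * W' (line c (t + 1 + n))
        rw [h1, h2]
  have ha : ∀ W W' : GaugeField P j G, (∀ s, s < t → W (line c s) = W' (line c s)) → pathProd W c t = pathProd W' c t := by
    intro W W' hWW'
    have : ∀ n, n ≤ t → pathProd W c n = pathProd W' c n := by
      intro n hn
      induction n with
      | zero => rfl
      | succ n ih => simp only [pathProd, ih (by omega), hWW' n (by omega)]
    exact this t le_rfl
  obtain ⟨b, hb1, hb2⟩ := hb (P.L - (t + 1))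
  have hL : t + 1 + (P.L - (t + 1)) = P.L := by omega
  refine ⟨fun W => pathProd W c t, b, fun W => ?_, fun W W' hWW' => ⟨ha W W' fun s hs => hWW' s (by omega) (by omega), hb2 W W' fun s hs hst => hWW' s (by omega) hst⟩⟩
  rw [axialAvg, ← hL, hb1 W]

end Geometry

section Reindex

variable {ι ι' : Type*} {G : Type*} [MeasurableSpace G]

/-- Reindexing along an equivalence with constant fibres: `(piCongrLeft (fun _ => G) f) g i = g (f.symm i)` (the cast in `Equiv.piCongrLeft_apply` is trivial on a constant family). [folklore] -/
theorem piCongrLeft_const_apply (f : ι' ≃ ι) (g : ι' → G) (i : ι) :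
    MeasurableEquiv.piCongrLeft (fun _ : ι => G) f g i = g (f.symm i) := by
  rw [MeasurableEquiv.coe_piCongrLeft, Equiv.piCongrLeft_apply_eq_cast]
  rfl

end Reindex

section Split

variable {P : Params} {j : ℕ} {G : Type} [GaugeGroup G] [MeasurableSpace G] [HaarData G]

omit [GaugeGroup G] [HaarData G] in
/-- The inverse splitting: the `¬B` component off `B`, the `B` component on `B`. [folklore] -/
theorem splitEquiv_symm_apply (B : PBond P j → Prop) [DecidablePred B] (x : {b : PBond P j // ¬ B b} → G) (y : {b : PBond P j // ¬¬ B b} → G) (b : PBond P j) :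
    (FibreSplit.splitEquiv B (P := P) (G := G)).symm (x, y) b = if h : ¬ B b then x ⟨b, h⟩ else y ⟨b, h⟩ := rfl

end Split

/-! ## §2 The frozen-fibre push-forward; §3 forgetting -/
section Forget

variable {P : Params} {j : ℕ} {G : Type} [GaugeGroup G] [MeasurableSpace G] [HaarData G] [MeasurableMul₂ G]

/-- ★★ **THE FROZEN-FIBRE PUSH-FORWARD IS PRODUCT HAAR**: freeze the variables of the non-selected bonds at `wZ`; the map sending the selected-bond variables `wB` to the axial
average of the joined field pushes product Haar on the selected bonds to product Haar on the coarse bonds — every coarse `W̄(c) = a_c · W(line c (τ c)) · b_c` with `a_c, b_c`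
frozen (`pathProd_split`, `line_inj`), a two-sided translate of a fresh Haar variable, and `c ↦ line c (τ c)` is a bijection onto the selected bonds. [folklore] -/
theorem map_axialAvg_join_eq (hj : j + 1 ≤ P.m + P.K) (τ : PBond P (j + 1) → ℕ) (hτ : ∀ c, τ c < P.L) [DecidablePred fun b : PBond P j => ∃ c, line c (τ c) = b]
    (wZ : {b : PBond P j // ¬ ∃ c, line c (τ c) = b} → G) :
    (Measure.pi fun _ : {b : PBond P j // ¬¬ ∃ c, line c (τ c) = b} => (HaarData.haar : Measure G)).map
        (fun wB => axialAvg ((FibreSplit.splitEquiv (fun b : PBond P j => ∃ c, line c (τ c) = b) (P := P) (G := G)).symm (wZ, wB))) =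
      fieldMeasure P (j + 1) G := by
  have hsel_inj := selected_injective hj τ hτ
  let e : PBond P (j + 1) ≃ {b : PBond P j // ¬¬ ∃ c, line c (τ c) = b} :=
    Equiv.ofBijective (fun c => ⟨line c (τ c), not_not.2 ⟨c, rfl⟩⟩)
      ⟨fun c c' h => hsel_inj (congrArg Subtype.val h), fun b => by
        obtain ⟨c, hc⟩ := not_not.1 b.2
        exact ⟨c, Subtype.ext hc⟩⟩
  have he : ∀ c, (e c : PBond P j) = line c (τ c) := fun c => rfl
  choose a b hab hinv using fun c => pathProd_split (P := P) (G := G) c (hτ c)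
  set W₀ : GaugeField P j G := (FibreSplit.splitEquiv (fun b : PBond P j => ∃ c, line c (τ c) = b) (P := P) (G := G)).symm (wZ, fun _ => 1) with hW₀
  have hM : (fun wB : {b : PBond P j // ¬¬ ∃ c, line c (τ c) = b} → G =>
        axialAvg ((FibreSplit.splitEquiv (fun b : PBond P j => ∃ c, line c (τ c) = b) (P := P) (G := G)).symm (wZ, wB))) =
      (fun V : GaugeField P (j + 1) G => fun c => V c * b c W₀) ∘ (fun V : GaugeField P (j + 1) G => fun c => a c W₀ * V c) ∘
        ⇑(MeasurableEquiv.piCongrLeft (fun _ : PBond P (j + 1) => G) e.symm) := by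
    funext wB c
    simp only [Function.comp_apply, piCongrLeft_const_apply, Equiv.symm_symm]
    have hW : ∀ s, s < P.L → s ≠ τ c →
        (FibreSplit.splitEquiv (fun b : PBond P j => ∃ c, line c (τ c) = b) (P := P) (G := G)).symm (wZ, wB) (line c s) = W₀ (line c s) := by
      intro s hs hst
      have hnot : ¬ ∃ c', line c' (τ c') = line c s := by
        rintro ⟨c', hc'⟩
        obtain ⟨h1, h2⟩ := line_inj hj (hτ c') hs hc'
        subst h1
        exact hst h2.symm
      rw [hW₀, splitEquiv_symm_apply, splitEquiv_symm_apply, dif_pos hnot, dif_pos hnot]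
    obtain ⟨ha', hb'⟩ := hinv c _ _ hW
    rw [hab c, ha', hb']
    have hsel : (FibreSplit.splitEquiv (fun b : PBond P j => ∃ c, line c (τ c) = b) (P := P) (G := G)).symm (wZ, wB) (line c (τ c)) = wB (e c) := by
      have hBc : ¬¬ ∃ c', line c' (τ c') = line c (τ c) := not_not.2 ⟨c, rfl⟩
      rw [splitEquiv_symm_apply, dif_neg hBc]
      rfl
    rw [hsel]
  rw [hM]
  have h1 : MeasurePreserving (⇑(MeasurableEquiv.piCongrLeft (fun _ : PBond P (j + 1) => G) e.symm))
      (Measure.pi fun _ : {b : PBond P j // ¬¬ ∃ c, line c (τ c) = b} => (HaarData.haar : Measure G)) (fieldMeasure P (j + 1) G) := by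
    unfold fieldMeasure
    exact measurePreserving_piCongrLeft (fun _ : PBond P (j + 1) => (HaarData.haar : Measure G)) e.symm
  have h2 := measurePreserving_mulLeft (P := P) (j := j + 1) (G := G) (fun c => a c W₀)
  have h3 := measurePreserving_mulRight (P := P) (j := j + 1) (G := G) (fun c => b c W₀)
  exact ((h3.comp h2).comp h1).map_eq

/-- ★★★ **AXIAL DECIMATION FORGETS EVERY DENSITY THAT MISSES ONE BOND PER LINE — the renormalization-image form**: if `ρ` is integrable and LOCAL OFF THE SELECTED BONDS
(`ρ W = ρ W′` whenever `W`, `W′` agree off `{line c (τ c)}`, one position `τ c < L` per line, any selection `τ`), then the CONSTANT `∫ρ dU` is a renormalization image of `ρ`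
along the axial average: `∫ (∫ρ)·f dV = ∫ ρ·(f∘axial) dU` for every bounded measurable `f` (Fubini over the splitting selected ∕ non-selected bonds — pub-balaban3d's
`FibreSplit` — and the frozen-fibre push-forward). [cite: Balaban1985UV3, (10) p.258 + (2) p.256 (bookkeeping); Balaban1985Averaging, (15) p.19] -/
theorem isRT_axial_const_of_localOff (hj : j + 1 ≤ P.m + P.K) (τ : PBond P (j + 1) → ℕ) (hτ : ∀ c, τ c < P.L)
    (ρ : Density P j G) (hρ : Integrable ρ (fieldMeasure P j G))
    (hloc : ∀ W W' : GaugeField P j G, (∀ b, (¬ ∃ c, line c (τ c) = b) → W b = W' b) → ρ W = ρ W') :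
    IsRT (axialAvg : GaugeField P j G → GaugeField P (j + 1) G) ρ (fun _ => ∫ U, ρ U ∂(fieldMeasure P j G)) := by
  classical
  intro f hf hfC
  obtain ⟨C, hC⟩ := hfC
  set B : PBond P j → Prop := fun b => ∃ c, line c (τ c) = b with hB
  -- notation for the joined field and the frozen value of `ρ`
  have hρc : ∀ (wZ : {b : PBond P j // ¬ B b} → G) (wB : {b : PBond P j // ¬¬ B b} → G),
      ρ ((FibreSplit.splitEquiv B (P := P) (G := G)).symm (wZ, wB)) = ρ ((FibreSplit.splitEquiv B (P := P) (G := G)).symm (wZ, fun _ => 1)) := by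
    intro wZ wB
    refine hloc _ _ fun b hb => ?_
    rw [splitEquiv_symm_apply, splitEquiv_symm_apply, dif_pos hb, dif_pos hb]
  -- integrability of `ρ · (f ∘ axial)`
  have hint : Integrable (fun U => ρ U * f (axialAvg U)) (fieldMeasure P j G) :=
    hρ.mul_bdd (hf.comp measurable_axialAvg).aestronglyMeasurable
      (Filter.Eventually.of_forall fun U => by rw [Real.norm_eq_abs]; exact hC _)
  -- `∫ρ dU` as an iterated integral: the inner integral is constant
  have hρsplit : ∫ U, ρ U ∂(fieldMeasure P j G) =
      ∫ wZ, ρ ((FibreSplit.splitEquiv B (P := P) (G := G)).symm (wZ, fun _ => 1))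
        ∂(Measure.pi fun _ : {b : PBond P j // ¬ B b} => (HaarData.haar : Measure G)) := by
    rw [FibreSplit.integral_fieldMeasure_split B ρ hρ]
    refine integral_congr_ae (Filter.Eventually.of_forall fun wZ => ?_)
    show ∫ wB, ρ ((FibreSplit.splitEquiv B (P := P) (G := G)).symm (wZ, wB)) ∂_ = _
    simp_rw [hρc wZ]
    rw [integral_const, probReal_univ, one_smul]
  -- the right-hand side, split
  rw [FibreSplit.integral_fieldMeasure_split B _ hint]
  have hinner : ∀ wZ : {b : PBond P j // ¬ B b} → G,
      ∫ wB, ρ ((FibreSplit.splitEquiv B (P := P) (G := G)).symm (wZ, wB)) * f (axialAvg ((FibreSplit.splitEquiv B (P := P) (G := G)).symm (wZ, wB)))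
          ∂(Measure.pi fun _ : {b : PBond P j // ¬¬ B b} => (HaarData.haar : Measure G)) =
        ρ ((FibreSplit.splitEquiv B (P := P) (G := G)).symm (wZ, fun _ => 1)) * ∫ V, f V ∂(fieldMeasure P (j + 1) G) := by
    intro wZ
    simp_rw [hρc wZ]
    rw [integral_const_mul]
    congr 1
    have hM := map_axialAvg_join_eq (P := P) (G := G) hj τ hτ wZ
    have hmeas : Measurable fun wB : {b : PBond P j // ¬¬ B b} → G => axialAvg ((FibreSplit.splitEquiv B (P := P) (G := G)).symm (wZ, wB)) :=
      measurable_axialAvg.comp ((FibreSplit.splitEquiv B (P := P) (G := G)).symm.measurable.comp (measurable_const.prodMk measurable_id))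
    rw [← hM, integral_map hmeas.aemeasurable hf.aestronglyMeasurable]
  simp_rw [hinner]
  rw [integral_mul_const, hρsplit, integral_const_mul]

/-- ★★★ **AXIAL DECIMATION FORGETS EVERY DENSITY THAT MISSES ONE BOND PER LINE**: for any selection `τ` of one bond position per line (`τ c < L`) and any integrable `ρ` local off the
selected bonds, `T^{axial}ρ = ∫ρ dU` `dV`-a.e. (uniqueness of renormalization images, pub-balaban3d's `RTAlgebra.IsRT.ae_eq`).  File 32's last-bond case is `τ ≡ L − 1`; the
mechanism is the same fibre by fibre: the coarse variable of line `c` is `a_c · W(line c (τ c)) · b_c` with `a_c, b_c` frozen, a two-sided translate of a fresh Haar variable.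
[cite: Balaban1985UV3, (10) p.258 + (2) p.256 (bookkeeping); Balaban1985Averaging, (15) p.19] -/
theorem rnTransport_axial_ae_eq_integral_of_localOff (hj : j + 1 ≤ P.m + P.K) (τ : PBond P (j + 1) → ℕ) (hτ : ∀ c, τ c < P.L)
    (ρ : Density P j G) (hρ : Integrable ρ (fieldMeasure P j G))
    (hloc : ∀ W W' : GaugeField P j G, (∀ b, (¬ ∃ c, line c (τ c) = b) → W b = W' b) → ρ W = ρ W') :
    rnTransport (axialAvg : GaugeField P j G → GaugeField P (j + 1) G) ρ =ᵐ[fieldMeasure P (j + 1) G] fun _ => ∫ U, ρ U ∂(fieldMeasure P j G) := by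
  have hac : AvgAC (axialAvg : GaugeField P j G → GaugeField P (j + 1) G) := AvgAC.of_map_eq measurable_axialAvg (map_axialAvg hj)
  exact RTAlgebra.IsRT.ae_eq (isRT_rnTransport_of_ac hac ρ hρ) (isRT_axial_const_of_localOff hj τ hτ ρ hρ hloc) measurable_axialAvg hρ
    (integrable_rnTransport _ ρ hρ) (integrable_const _)

/-- ★★ **MEASURE FORM: `(ρ·dU)∘axial⁻¹ = (∫ρ dU)·dV`** for a non-negative integrable density local off the selected bonds (file 25's exact transport + §3).
[cite: Balaban1985UV3, (10) p.258 (bookkeeping); Balaban1985Averaging, (15) p.19] -/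
theorem map_axialAvg_withDensity_of_localOff (hj : j + 1 ≤ P.m + P.K) (τ : PBond P (j + 1) → ℕ) (hτ : ∀ c, τ c < P.L)
    (ρ : Density P j G) (hρ0 : ∀ W, 0 ≤ ρ W) (hρ : Integrable ρ (fieldMeasure P j G))
    (hloc : ∀ W W' : GaugeField P j G, (∀ b, (¬ ∃ c, line c (τ c) = b) → W b = W' b) → ρ W = ρ W') :
    ((fieldMeasure P j G).withDensity fun W => ENNReal.ofReal (ρ W)).map (axialAvg : GaugeField P j G → GaugeField P (j + 1) G) =
      ENNReal.ofReal (∫ W, ρ W ∂(fieldMeasure P j G)) • fieldMeasure P (j + 1) G := by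
  have hac : AvgAC (axialAvg : GaugeField P j G → GaugeField P (j + 1) G) := AvgAC.of_map_eq measurable_axialAvg (map_axialAvg hj)
  have h1 : ((fieldMeasure P j G).withDensity fun W => ENNReal.ofReal (ρ W)).map (axialAvg : GaugeField P j G → GaugeField P (j + 1) G) =
      pushDensity (axialAvg : GaugeField P j G → GaugeField P (j + 1) G) ρ := rfl
  rw [h1, ← withDensity_rnTransport_eq_pushDensity hac hρ0 hρ, ← withDensity_const]
  refine withDensity_congr_ae ?_
  filter_upwards [rnTransport_axial_ae_eq_integral_of_localOff hj τ hτ ρ hρ hloc] with V hV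
  rw [hV]

end Forget

/-! ## §4 At print's averaging: forgetting + fresh defects, general position -/
section Print

open Literature.MathematicalPhysics.QuantumFieldTheory.Balaban1985CMP102.Setting (Scales)
open Literature.MathematicalPhysics.QuantumFieldTheory.Balaban1983to89.B10RunsOfRecord (avOfPrint)
open Literature.MathematicalPhysics.QuantumFieldTheory.Balaban1983to89.ExpMeanLog (expMeanLogSU)
open Literature.MathematicalPhysics.QuantumFieldTheory.Balaban1983to89.BlockAveraging (Small)
open Literature.MathematicalPhysics.QuantumFieldTheory.Balaban1983to89.Node00 (SU)
open Summit.QuantumFields.YangMills.BalabanUVNodes.N08HaarCompatibilityGuardTransport (map_avOfPrint_le)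
open Summit.QuantumFields.YangMills.BalabanUVNodes.N08Thm2AtRecordBridgeInhabited (avgAC_avOfPrint)

variable (N : ℕ) [NeZero N] {L : ℕ} (S : Scales L) {j : ℕ}

/-- ★★★ **FORGETTING + FRESH DEFECTS AT PRINT'S AVERAGING, GENERAL POSITION**: for [Balaban1985Averaging] (15) on `SU(N)`, any selection `τ` (`τ c < L`) and every non-negative
integrable density `ρ` local off the selected bonds, `(ρ·dU_j)∘Ū_j⁻¹ ≤ (∫ρ dU_j)·dU_{j+1} + ((ρ·dU_j)↾G_j)∘Ū_j⁻¹` (`G_j` the small-field guard, `j + 1 ≤ K`): the sup of `ρ` does not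
propagate through the step; only guard events create density. [cite: Balaban1985Averaging, (15) p.19; Balaban1987RG1, (0.4) p.253; Balaban1985UV3, (2) p.256] -/
theorem map_avOfPrint_withDensity_le_of_localOff (hj : j + 1 ≤ S.K) (τ : PBond S.P (j + 1) → ℕ) (hτ : ∀ c, τ c < S.P.L)
    (ρ : Density S.P j (SU N)) (hρ0 : ∀ W, 0 ≤ ρ W) (hρ : Integrable ρ (fieldMeasure S.P j (SU N)))
    (hloc : ∀ W W' : GaugeField S.P j (SU N), (∀ b, (¬ ∃ c, line c (τ c) = b) → W b = W' b) → ρ W = ρ W') :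
    ((fieldMeasure S.P j (SU N)).withDensity fun W => ENNReal.ofReal (ρ W)).map (avOfPrint N S j).avg ≤
      ENNReal.ofReal (∫ W, ρ W ∂(fieldMeasure S.P j (SU N))) • fieldMeasure S.P (j + 1) (SU N) +
        (((fieldMeasure S.P j (SU N)).withDensity fun W => ENNReal.ofReal (ρ W)).restrict
            {U : GaugeField S.P j (SU N) | ∃ c : PBond S.P (j + 1), Small (expMeanLogSU : LoopAverage (SU N)) U c}).map (avOfPrint N S j).avg := by
  have hjr : j + 1 ≤ S.P.m + S.P.K := by show j + 1 ≤ S.m + S.K; omega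
  have h := map_avOfPrint_le N S hjr ((fieldMeasure S.P j (SU N)).withDensity fun W => ENNReal.ofReal (ρ W))
  rwa [map_axialAvg_withDensity_of_localOff hjr τ hτ ρ hρ0 hρ hloc] at h

/-- ★★ **ONE FLOORED STEP WITHOUT STACKING, GENERAL POSITION**: if `f ≥ 1` is integrable and local off some one-bond-per-line selection `τ`, then at print's averaging
`max(1, T_j f)·dU_{j+1} ≤ (∫f dU_j)·dU_{j+1} + ((f·dU_j)↾G_j)∘Ū_j⁻¹` (`j + 1 ≤ K`): NEW EXCESS ≤ OLD EXCESS MASS + FRESH GUARD DEFECTS — the sup of `f` never enters.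
[cite: Balaban1985UV3, (41) p.266 + (47) p.267 + (2) p.256; Balaban1985Averaging, (15) p.19; Balaban1987RG1, (0.4) p.253] -/
theorem floorStep_le_of_localOff (hj : j + 1 ≤ S.K) (τ : PBond S.P (j + 1) → ℕ) (hτ : ∀ c, τ c < S.P.L)
    (f : Density S.P j (SU N)) (hf1 : ∀ W, 1 ≤ f W) (hf : Integrable f (fieldMeasure S.P j (SU N)))
    (hloc : ∀ W W' : GaugeField S.P j (SU N), (∀ b, (¬ ∃ c, line c (τ c) = b) → W b = W' b) → f W = f W') :
    (fieldMeasure S.P (j + 1) (SU N)).withDensity (fun V => ENNReal.ofReal (max 1 (rnTransport (avOfPrint N S j).avg f V))) ≤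
      ENNReal.ofReal (∫ W, f W ∂(fieldMeasure S.P j (SU N))) • fieldMeasure S.P (j + 1) (SU N) +
        (((fieldMeasure S.P j (SU N)).withDensity fun W => ENNReal.ofReal (f W)).restrict
            {U : GaugeField S.P j (SU N) | ∃ c : PBond S.P (j + 1), Small (expMeanLogSU : LoopAverage (SU N)) U c}).map (avOfPrint N S j).avg := by
  have hf0 : ∀ W, 0 ≤ f W := fun W => zero_le_one.trans (hf1 W)
  have hmean : (1 : ℝ) ≤ ∫ W, f W ∂(fieldMeasure S.P j (SU N)) := by
    have := integral_mono (integrable_const (1 : ℝ)) hf (fun W => hf1 W)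
    simpa using this
  have hT : (fieldMeasure S.P (j + 1) (SU N)).withDensity (fun V => ENNReal.ofReal (rnTransport (avOfPrint N S j).avg f V)) ≤
      ENNReal.ofReal (∫ W, f W ∂(fieldMeasure S.P j (SU N))) • fieldMeasure S.P (j + 1) (SU N) +
        (((fieldMeasure S.P j (SU N)).withDensity fun W => ENNReal.ofReal (f W)).restrict
            {U : GaugeField S.P j (SU N) | ∃ c : PBond S.P (j + 1), Small (expMeanLogSU : LoopAverage (SU N)) U c}).map (avOfPrint N S j).avg := by
    rw [withDensity_rnTransport_eq_pushDensity (avgAC_avOfPrint N L S j) hf0 hf]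
    exact map_avOfPrint_withDensity_le_of_localOff N S hj τ hτ f hf0 hf hloc
  have hone : (fieldMeasure S.P (j + 1) (SU N)).withDensity (fun _ => (1 : ℝ≥0∞)) ≤
      ENNReal.ofReal (∫ W, f W ∂(fieldMeasure S.P j (SU N))) • fieldMeasure S.P (j + 1) (SU N) +
        (((fieldMeasure S.P j (SU N)).withDensity fun W => ENNReal.ofReal (f W)).restrict
            {U : GaugeField S.P j (SU N) | ∃ c : PBond S.P (j + 1), Small (expMeanLogSU : LoopAverage (SU N)) U c}).map (avOfPrint N S j).avg := by
    rw [withDensity_const, one_smul]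
    refine le_trans ?_ (Measure.le_add_right le_rfl)
    have hc : (1 : ℝ≥0∞) ≤ ENNReal.ofReal (∫ W, f W ∂(fieldMeasure S.P j (SU N))) := by
      rw [← ENNReal.ofReal_one]; exact ENNReal.ofReal_le_ofReal hmean
    refine Measure.le_iff'.2 fun s => ?_
    rw [Measure.smul_apply, smul_eq_mul]
    calc fieldMeasure S.P (j + 1) (SU N) s = 1 * fieldMeasure S.P (j + 1) (SU N) s := (one_mul _).symm
      _ ≤ ENNReal.ofReal (∫ W, f W ∂(fieldMeasure S.P j (SU N))) * fieldMeasure S.P (j + 1) (SU N) s := mul_le_mul_left hc _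
  have heq : (fun V => ENNReal.ofReal (max 1 (rnTransport (avOfPrint N S j).avg f V))) =
      fun V => max ((fun _ => (1 : ℝ≥0∞)) V) (ENNReal.ofReal (rnTransport (avOfPrint N S j).avg f V)) := by
    funext V; rw [ENNReal.ofReal_max, ENNReal.ofReal_one]
  rw [heq]
  exact N08MassesACLeastClosedFamily.withDensity_sup_le measurable_const (measurable_rnTransport _ _).ennreal_ofReal hone hT

/-- ★★ **THE «OLD EXCESS MASS» IS AT MOST `1 +` THE SUM OF THE GUARD PROBABILITIES**: at print's averaging the floored Haar iterate `f_k = massRecAC … (avOfPrint N S) k triv` has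
`∫ f_k dU_k ≤ 1 + Σ_{j<k} dU_j(G_j)` (`k ≤ K`; file 28's `lintegral_massRecAC_triv_le` — the one-step excess masses add up — and file 17b's `oneStepExcess_avOfPrint_le_guard` — each
one-step excess is at most the image of the guarded part, whose mass is the guard probability).  So in §4's floored step the MEAN term is `1 +` a sum of (small) guard
probabilities, never a product of sups. [cite: Balaban1985UV3, (41) p.266 + (47) p.267; Balaban1987RG1, (0.4) p.253; Balaban1985Averaging, (15) p.19] -/
theorem lintegral_massRecAC_triv_avOfPrint_le_one_add_sum_guard (M₁ : ℕ) (Rcol : ℕ → ℕ) (εL εS : ℕ → ℝ) {k : ℕ} (hk : k ≤ S.K) :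
    ∫⁻ V, ENNReal.ofReal (MassesAC.massRecAC M₁ Rcol εL εS (avOfPrint N S) k (Hist.triv S.P k) V) ∂(fieldMeasure S.P k (SU N)) ≤
      1 + ∑ j ∈ Finset.range k,
        fieldMeasure S.P j (SU N) {U : GaugeField S.P j (SU N) | ∃ c : PBond S.P (j + 1), Small (expMeanLogSU : LoopAverage (SU N)) U c} := by
  obtain ⟨νs, h0, hsucc⟩ := N08MassesACLeastClosedFamily.exists_excessRec (avOfPrint N S)
  have h := N08TrivialHistoryDominates.lintegral_massRecAC_triv_le M₁ Rcol εL εS (avgAC_avOfPrint N L S) νs h0 hsucc (k := k)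
    (by show k ≤ S.m + S.K + 1; omega)
  refine h.trans (add_le_add le_rfl (Finset.sum_le_sum fun j hj => ?_))
  have hjK : j + 1 ≤ S.K := by have := Finset.mem_range.1 hj; omega
  have hmeas : Measurable (avOfPrint N S j).avg := (avgAC_avOfPrint N L S j).1
  calc ((fieldMeasure S.P j (SU N)).map (avOfPrint N S j).avg - fieldMeasure S.P (j + 1) (SU N)) Set.univ
      ≤ ((fieldMeasure S.P j (SU N)).restrict
          {U : GaugeField S.P j (SU N) | ∃ c : PBond S.P (j + 1), Small (expMeanLogSU : LoopAverage (SU N)) U c}).map (avOfPrint N S j).avg Set.univ :=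
        N08MassesACLeastClosedFamilyPrint.oneStepExcess_avOfPrint_le_guard N S j hjK Set.univ
    _ = fieldMeasure S.P j (SU N) {U : GaugeField S.P j (SU N) | ∃ c : PBond S.P (j + 1), Small (expMeanLogSU : LoopAverage (SU N)) U c} := by
        rw [Measure.map_apply hmeas MeasurableSet.univ, Set.preimage_univ, Measure.restrict_apply_univ]

end Print

end Summit.QuantumFields.YangMills.BalabanUVNodes.N08AxialDecimationForgetsSelected

end
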